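import Summits.AtomisticToContinuum.Crystallization.Theorems.FrustratedLawDichotomyStrainedPatchHomEntrySign
import Summits.AtomisticToContinuum.Crystallization.Theorems.FrustratedLawDichotomyStrainedPatchHomEntryBest

/-!
# The fcc certificate of `(H)` over the FUNDAMENTAL DOMAIN with the verdict OF RECORD: `signOut ∨ domOut ∨ entryLeafOKB μ`

decomp-a2c hand-2 g23 (crux `AperiodicFrustratedLawGap`, stmt-AtomisticToContinuum-27623; the adapter owed in critic row 842 (A)).
Hand-1's symmetry reduction (`…HomEntrySym` ×6, `…HomEntrySignKit`/`…HomEntrySign` ×4: the fundamental domain `u₁₁ ≤ u₀₀`, `u₂₂ ≤ u₁₁`,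
`0 ≤ u₀₁`, `0 ≤ u₀₂` of the entry cube) was stated for hand-1's kernel verdict `entryLeafOKT μ` (fit ∨ symmetry ∨ column ∨ table).  This file
puts the fcc verdict OF RECORD `entryLeafOKB μ` (`…HomEntryBest`: Cartesian sharp fit `fitOK3` ∨ sharp fit `fitOK2` ∨ `fitOK` ∨ `asymOK` ∨
`colOutOK` ∨ table) behind the two vacuous-leaf prunes of the domain:

* ★ `entryLeafOKDB μ := signOut ∨ domOut ∨ entryLeafOKB μ` and its soundness RELATIVE to the fundamental domain;
* ★★ `fccHalf_of_entryTreeDomBest` / `fccHalf_of_entrySearchDomBest`: the fcc half (`hfcc` of `…HomPrunedPolar.homFloor_of_prunedBoxSums_selfAdjoint`,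
  verbatim, for ALL self-adjoint positive `U` with `‖U − 1‖ ≤ 1/4`) from ONE tree / search Boolean over the fundamental domain;
* ★★★ `homFloor_of_domBestSearches` (every `m`, `μ` with `2(m + e_W)·SC ≤ μ`) and the two closing forms at `m = 1/625`, `μ = muRec`:
  `homFloor_625_of_domBestSearches` (search Booleans, no tree literal) and `homFloor_625_of_domBestTrees` (tree Booleans).

So census H-FCC-COUNT's instrument of record becomes `searchLeaves (entryLeafOKDB muRec) rr9 F 0 rootC rootW` (≈ 1/24 of the entry cube, sharpest
fit prunes), hcp side unchanged (`entryLeafOKH2 muRec`).  One definition; 0 sorry; standard axioms; no instances / notation / `#eval`.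
`--supports stmt-AtomisticToContinuum-27623`.
-/

namespace Summit.AtomisticToContinuum.Crystallization.Theorems.FrustratedLawDichotomyStrainedPatchHomEntryDomBest

open scoped BigOperators RealInnerProductSpace
open Literature.Analysis.ValidatedNumerics.Numerics
open Summit.AtomisticToContinuum.Crystallization.Theorems.ChargedEnergyGapNegative (E3)
open Summit.AtomisticToContinuum.Crystallization.Theorems.FrustratedLawDichotomySchurCut (effPot w₄₅ ω₄)
open Summit.AtomisticToContinuum.Crystallization.Theorems.FrustratedLawDichotomyAveragingRuleTightFree (TightNearCap BadNearCap)
open Summit.AtomisticToContinuum.Crystallization.Theorems.FrustratedLawDichotomyExemptAbsorption (ExemptNear)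
open Summit.AtomisticToContinuum.Crystallization.Theorems.FrustratedLawDichotomyStrainedPatchHomSplit
open Summit.AtomisticToContinuum.Crystallization.Theorems.FrustratedLawDichotomyStrainedPatchHomPrunedPolar (homFloor_of_prunedBoxSums_selfAdjoint)
open Summit.AtomisticToContinuum.Crystallization.Theorems.FrustratedLawDichotomyStrainedPatchHomCertTree (CertTree treeOK)
open Summit.AtomisticToContinuum.Crystallization.Theorems.FrustratedLawDichotomyStrainedPatchHomEntryGram
open Summit.AtomisticToContinuum.Crystallization.Theorems.FrustratedLawDichotomyStrainedPatchHomEntryGramHcp (rootCH rootWH)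
open Summit.AtomisticToContinuum.Crystallization.Theorems.FrustratedLawDichotomyStrainedPatchHomEntryFitHcp
  (entryLeafOKH2 entryLeafOKH2_sound hcpHalf_of_entryFitTree)
open Summit.AtomisticToContinuum.Crystallization.Theorems.FrustratedLawDichotomyStrainedPatchHomEntryTable (muRec muRec_ok)
open Summit.AtomisticToContinuum.Crystallization.Theorems.FrustratedLawDichotomyStrainedPatchHomEntrySearch
open Summit.AtomisticToContinuum.Crystallization.Theorems.FrustratedLawDichotomyStrainedPatchHomEntrySym (domOut false_of_domOut)
open Summit.AtomisticToContinuum.Crystallization.Theorems.FrustratedLawDichotomyStrainedPatchHomEntrySign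
  (signOut false_of_signOut fccHalf_of_entryTreeDom)
open Summit.AtomisticToContinuum.Crystallization.Theorems.FrustratedLawDichotomyStrainedPatchHomEntryBest (entryLeafOKB entryLeafOKB_sound)
open Literature.Barriers.AtomisticToContinuum.FlatleyTheil2015 (fccVec)

/-! ## §1. The verdict of record over the fundamental domain -/

/-- ★ **fcc ENTRY-LEAF VERDICT OF RECORD OVER THE FUNDAMENTAL DOMAIN**: sign prune ∨ sorted-diagonal prune ∨ `entryLeafOKB μ`
(Cartesian sharp fit ∨ sharp fit ∨ fit ∨ symmetry ∨ column ∨ table). -/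
def entryLeafOKDB (μ : ℤ) (c w : Fin 3 × Fin 3 → ℤ) : Bool := signOut c w || domOut c w || entryLeafOKB μ c w

/-- ★ Soundness of `entryLeafOKDB` RELATIVE to the fundamental domain (`u₁₁ ≤ u₀₀`, `u₂₂ ≤ u₁₁`, `0 ≤ u₀₁`, `0 ≤ u₀₂`): the shape of the
`hver` hypothesis of `…HomEntrySign.fccHalf_of_entryTreeDom`. [folklore] -/
theorem entryLeafOKDB_sound {μ : ℤ} {c w : Fin 3 × Fin 3 → ℤ} (h : entryLeafOKDB μ c w = true) (U : E3 →L[ℝ] E3)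
    (hsa : ∀ v v' : E3, ⟪U v, v'⟫ = ⟪v, U v'⟫) (hU : ‖U - 1‖ ≤ 1 / 4)
    (hbox : ∀ ab : Fin 3 × Fin 3, |(U (EuclideanSpace.single ab.2 (1 : ℝ))) ab.1 - (c ab : ℝ) / SC| ≤ (w ab : ℝ) / SC)
    (h1 : (U (EuclideanSpace.single 1 (1 : ℝ))) 1 ≤ (U (EuclideanSpace.single 0 (1 : ℝ))) 0)
    (h2 : (U (EuclideanSpace.single 2 (1 : ℝ))) 2 ≤ (U (EuclideanSpace.single 1 (1 : ℝ))) 1)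
    (h01 : 0 ≤ (U (EuclideanSpace.single 1 (1 : ℝ))) 0) (h02 : 0 ≤ (U (EuclideanSpace.single 2 (1 : ℝ))) 0) :
    (∀ (M : ℕ) (z : Fin M → E3) (c : Fin M), Function.Injective z →
        Set.range z = {x : E3 | dist x (z c) ≤ 133 / 10 ∧ ∃ a : Fin 3 → ℤ, x = z c + latPt U fccVec a} →
        TightNearCap (9 / 5) (3 / 2) z c ∨ ExemptNear (9 / 5) ExRec z c ∨ BadNearCap (9 / 5) (3 / 2) z c) ∨
      (μ : ℝ) / SC ≤ ∑ b ∈ (Fintype.piFinset fun _ : Fin 3 => Finset.Icc (-7 : ℤ) 7).filter (fun b => b ≠ 0),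
        effPot w₄₅ ω₄ (3 / 400) ‖latPt U fccVec b‖ := by
  simp only [entryLeafOKDB, Bool.or_eq_true] at h
  rcases h with (h | h) | h
  · exact (false_of_signOut h (u := fun ab : Fin 3 × Fin 3 => (U (EuclideanSpace.single ab.2 (1 : ℝ))) ab.1) hbox h01 h02).elim
  · exact (false_of_domOut h (u := fun ab : Fin 3 × Fin 3 => (U (EuclideanSpace.single ab.2 (1 : ℝ))) ab.1) hbox h1 h2).elim
  · exact entryLeafOKB_sound h U hsa hU hbox

/-! ## §2. The fcc half from one Boolean over the fundamental domain -/

/-- ★★ **THE fcc HALF FROM ONE TREE BOOLEAN over the fundamental domain with the verdict of record** (= `hfcc` of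
`…HomPrunedPolar.homFloor_of_prunedBoxSums_selfAdjoint`, verbatim, for ALL self-adjoint positive `U` with `‖U − 1‖ ≤ 1/4`). [folklore] -/
theorem fccHalf_of_entryTreeDomBest {m : ℝ} {μ : ℤ} (hμ : 2 * (m + (-(7175 / 10000) + 3 / 400)) * SC ≤ μ)
    {t : CertTree (Fin 3 × Fin 3)} (h : treeOK (entryLeafOKDB μ) t rootC rootW = true) :
    ∀ U : E3 →L[ℝ] E3, (∀ v w : E3, inner ℝ (U v) w = inner ℝ v (U w)) → (∀ w : E3, 0 ≤ inner ℝ w (U w)) → ‖U - 1‖ ≤ 1 / 4 →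
      (∀ (M : ℕ) (z : Fin M → E3) (c : Fin M), Function.Injective z →
          Set.range z = {x : E3 | dist x (z c) ≤ 133 / 10 ∧ ∃ a : Fin 3 → ℤ, x = z c + latPt U fccVec a} →
          TightNearCap (9 / 5) (3 / 2) z c ∨ ExemptNear (9 / 5) ExRec z c ∨ BadNearCap (9 / 5) (3 / 2) z c) ∨
      m ≤ (∑ b ∈ (Fintype.piFinset fun _ : Fin 3 => Finset.Icc (-7 : ℤ) 7).filter (fun b => b ≠ 0),
        effPot w₄₅ ω₄ (3 / 400) ‖latPt U fccVec b‖) / 2 - (-(7175 / 10000) + 3 / 400) :=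
  fccHalf_of_entryTreeDom hμ (entryLeafOKDB μ)
    (fun _ _ hv U hsa hU hbox h1 h2 h01 h02 => entryLeafOKDB_sound hv U hsa hU hbox h1 h2 h01 h02) h

/-- ★★ The same from ONE SEARCH Boolean (`…HomEntrySearch.searchOK`, no tree literal). [folklore] -/
theorem fccHalf_of_entrySearchDomBest {m : ℝ} {μ : ℤ} (hμ : 2 * (m + (-(7175 / 10000) + 3 / 400)) * SC ≤ μ)
    {sel : ℕ → (Fin 3 × Fin 3 → ℤ) → (Fin 3 × Fin 3 → ℤ) → Fin 3 × Fin 3} {fuel d : ℕ}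
    (h : searchOK (entryLeafOKDB μ) sel fuel d rootC rootW = true) :
    ∀ U : E3 →L[ℝ] E3, (∀ v w : E3, inner ℝ (U v) w = inner ℝ v (U w)) → (∀ w : E3, 0 ≤ inner ℝ w (U w)) → ‖U - 1‖ ≤ 1 / 4 →
      (∀ (M : ℕ) (z : Fin M → E3) (c : Fin M), Function.Injective z →
          Set.range z = {x : E3 | dist x (z c) ≤ 133 / 10 ∧ ∃ a : Fin 3 → ℤ, x = z c + latPt U fccVec a} →
          TightNearCap (9 / 5) (3 / 2) z c ∨ ExemptNear (9 / 5) ExRec z c ∨ BadNearCap (9 / 5) (3 / 2) z c) ∨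
      m ≤ (∑ b ∈ (Fintype.piFinset fun _ : Fin 3 => Finset.Icc (-7 : ℤ) 7).filter (fun b => b ≠ 0),
        effPot w₄₅ ω₄ (3 / 400) ‖latPt U fccVec b‖) / 2 - (-(7175 / 10000) + 3 / 400) := by
  obtain ⟨t, ht⟩ := exists_tree_of_searchOK (entryLeafOKDB μ) sel fuel d rootC rootW h
  exact fccHalf_of_entryTreeDomBest hμ ht

/-! ## §3. `(H) HomFloor` from two Booleans -/

/-- ★★★ **`(H) HomFloor m` FROM TWO SEARCH BOOLEANS** — fcc search over the fundamental domain with the verdict of record, hcp search with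
`entryLeafOKH2 μ`; every `m`, `μ` with `2 (m + e_W) SC ≤ μ`. [folklore] -/
theorem homFloor_of_domBestSearches {m : ℝ} {μ : ℤ} (hμ : 2 * (m + (-(7175 / 10000) + 3 / 400)) * SC ≤ μ)
    {selF : ℕ → (Fin 3 × Fin 3 → ℤ) → (Fin 3 × Fin 3 → ℤ) → Fin 3 × Fin 3} {fuelF dF : ℕ}
    (hF : searchOK (entryLeafOKDB μ) selF fuelF dF rootC rootW = true)
    {selH : ℕ → ((Fin 3 × Fin 3) ⊕ Fin 3 → ℤ) → ((Fin 3 × Fin 3) ⊕ Fin 3 → ℤ) → (Fin 3 × Fin 3) ⊕ Fin 3} {fuelH dH : ℕ}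
    (hH : searchOK (entryLeafOKH2 μ) selH fuelH dH rootCH rootWH = true) : HomFloor m :=
  homFloor_of_prunedBoxSums_selfAdjoint (fccHalf_of_entrySearchDomBest hμ hF)
    (hcpHalf_of_entrySearch hμ (entryLeafOKH2 μ) (fun _ _ hv U ξ hsa hU hbox hξ => entryLeafOKH2_sound hv U ξ hsa hU hbox hξ) hH)

/-- ★★★ **`(H) HomFloor (1/625)` FROM THE TWO SEARCH BOOLEANS OF RECORD** (`μ = muRec`; census H-FCC-COUNT / H-HCP-COUNT:
`searchOK (entryLeafOKDB muRec) rr9 F 0 rootC rootW = true`, `searchOK (entryLeafOKH2 muRec) rr12 F' 0 rootCH rootWH = true`, any selectors). [folklore] -/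
theorem homFloor_625_of_domBestSearches
    {selF : ℕ → (Fin 3 × Fin 3 → ℤ) → (Fin 3 × Fin 3 → ℤ) → Fin 3 × Fin 3} {fuelF dF : ℕ}
    (hF : searchOK (entryLeafOKDB muRec) selF fuelF dF rootC rootW = true)
    {selH : ℕ → ((Fin 3 × Fin 3) ⊕ Fin 3 → ℤ) → ((Fin 3 × Fin 3) ⊕ Fin 3 → ℤ) → (Fin 3 × Fin 3) ⊕ Fin 3} {fuelH dH : ℕ}
    (hH : searchOK (entryLeafOKH2 muRec) selH fuelH dH rootCH rootWH = true) : HomFloor (1 / 625) :=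
  homFloor_of_domBestSearches muRec_ok hF hH

/-- ★★★ **`(H) HomFloor (1/625)` FROM TWO TREE BOOLEANS** (fcc tree over the fundamental domain with the verdict of record, hcp tree with
`entryLeafOKH2 muRec`). [folklore] -/
theorem homFloor_625_of_domBestTrees {tF : CertTree (Fin 3 × Fin 3)} (hF : treeOK (entryLeafOKDB muRec) tF rootC rootW = true)
    {tH : CertTree ((Fin 3 × Fin 3) ⊕ Fin 3)} (hH : treeOK (entryLeafOKH2 muRec) tH rootCH rootWH = true) : HomFloor (1 / 625) :=
  homFloor_of_prunedBoxSums_selfAdjoint (fccHalf_of_entryTreeDomBest muRec_ok hF) (hcpHalf_of_entryFitTree muRec_ok hH)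

/-- Kernel smoke test: the two vacuous prunes fire on boxes outside the fundamental domain (`u₀₁ < 0` throughout; `u₀₀ < u₁₁` throughout)
and neither fires on the root cube. -/
example : entryLeafOKDB muRec (Function.update rootC (0, 1) (-3000)) (fun _ => 1000) = true ∧
    entryLeafOKDB muRec (Function.update rootC (1, 1) (rootC (1, 1) + 3000)) (fun _ => 1000) = true ∧
    signOut rootC rootW = false ∧ domOut rootC rootW = false := by
  decide +kernel

end Summit.AtomisticToContinuum.Crystallization.Theorems.FrustratedLawDichotomyStrainedPatchHomEntryDomBest
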